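/-
Copyright (c) 2026 the pub-hodgecm-mathlib formalisation cell (harness21).  Prover seat hodgecm-mathlib-A-p14 (g32), P6 «MOD programme»,
P6a desk F0P6a-plan (g1) ORGAN DEALS #1 (O-α) «HECKE–SERRE CONSTRUCTOR», FILE α2b; 2026-09-01.
-/
import Literature.AlgebraicGeometry.AbelianSchemes.LevelStructureOfIsogeny
import Literature.AlgebraicGeometry.AbelianSchemes.AbelianSchemeConstSubgroupQuotientKernel
import HarnessLib

/-!
# The level structure of the quotient `A ∕ K` by a finite constant subgroup of order prime to the level
# ([MumfordAV1970] §7 Thm. 4; [MumfordFogartyKirwan1994] Ch. 7 §1 Def. 7.1, App. 7A; [RapoportSmithlingZhang2020Diagonal] (4.23))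

Topic `AlgebraicGeometry/AbelianSchemes`, namespace `Literature.AlgebraicGeometry.AbelianSchemes.AbelianSchemeOver`.  THEOREMS ONLY (no definition, no named
fact, no `instance`, no notation, no `sorry`).  Cell `hodgecm-mathlib` (D-0151), F0/P6 «MOD», P6a desk F0P6a-plan (g1) ORGAN DEALS #1 **(O-α) «HECKE–SERRE
CONSTRUCTOR», FILE α2b** = row Q6 ∕ S4 (quotient half) of the census: the level component `lvl′` of `(A∕K, ρ′, D′, pol′, lvl′)` and the EXACT fibrewise kernel
bookkeeping of `ψ : A → A∕K` it needs, assembled BY NAME over ★ `LevelStructure.exists_comp_of_torsionBijOn` ∕ `eq_one_of_pow_eq_one_of_comp_eq_one` ∕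
`exists_pow_eq_one_and_comp_eq` (`LevelStructureOfIsogeny`) and ★ `comp_quotientMk_eq_one_iff` ∕ `quotientBy_ontoFibres` (`AbelianSchemeConstSubgroupQuotient{,Kernel}`);
`--supports stmt-HodgeConjecture-24832`, COUNT-NEUTRAL.  HONEST LABEL: HC_CM is proved only modulo the 2 remaining named inputs (hLiu418 24832, h413 24833) until
rung 0 closes; this file discharges none of them.

## Mathematics

`ψ : A → A∕K` (★ `quotientMk`, `Y` affine, `K` free on geometric points) is onto on geometric fibre points with kernel EXACTLY the restrictions `σ(s)`,
`σ ∈ K` (★).  If `K` is killed by `M` (`σ^M = 1` for `σ ∈ K`) then the fibrewise kernel of `ψ` is killed by `M` (§1), so for a level `n` with `(M, n) = 1`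
the map `ψ` is injective on `n`-torsion fibre points and maps them ONTO the `n`-torsion fibre points of `A∕K` (★ Bézout bookkeeping); hence (§2) a level-`n`
structure `φ` on `A` induces a level-`n` structure `ψφ` on `A∕K` with `ψφ.σ i = φ.σ i ≫ ψ`, unique with this property — [MumfordFogartyKirwan1994] App. 7A
(p. 235), [MumfordAV1970] §7 Thm. 4 (p. 72); this is the level entry `η ↦ ψ ∘ η` of the isogeny quotient `A′ = A∕C` in [RapoportSmithlingZhang2020Diagonal]
(4.23) p. 21 and [HarrisTaylorAMS2001] p. 110 (`α ∘ g`), for level prime to `p`.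

## Contents

* §1 **`pow_eq_one_of_comp_quotientMk_eq_one`** (`x ≫ ψ = 1 → x ^ M = 1` on geometric fibre points), `eq_one_of_pow_eq_one_of_comp_quotientMk_eq_one`
  (`ψ` injective on `n`-torsion, `(M, n) = 1`), `exists_pow_eq_one_and_comp_quotientMk_eq` (`ψ` onto on `n`-torsion).
* §2 **`LevelStructure.exists_comp_quotientMk_of_coprime`** (`∃ ψφ : (A∕K).LevelStructure g n, ∀ i, ψφ.σ i = φ.σ i ≫ ψ`) and
  **`LevelStructure.existsUnique_comp_quotientMk_of_coprime`**.

## References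
* [MumfordAV1970] D. Mumford, *Abelian Varieties* (1970), §7 Thm. 4 (p. 72).
* [MumfordFogartyKirwan1994] D. Mumford, J. Fogarty, F. Kirwan, *Geometric Invariant Theory*, 3rd ed. (1994), Ch. 7 §1 Def. 7.1 (p. 129), App. 7A (p. 235).
* [RapoportSmithlingZhang2020Diagonal] M. Rapoport, B. Smithling, W. Zhang (2020), §4, (4.23) (p. 21).
* [HarrisTaylorAMS2001] M. Harris, R. Taylor (2001), §III.4 (p. 110).
-/

set_option autoImplicit false

noncomputable section

universe u

open CategoryTheory CategoryTheory.Limits AlgebraicGeometry MonoidalCategory CartesianMonoidalCategory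
open scoped MonObj

namespace Literature.AlgebraicGeometry.AbelianSchemes

namespace AbelianSchemeOver

variable {S : Scheme.{u}} (A : AbelianSchemeOver S)
  {Y : Scheme.{u}} (u : S ⟶ Y) (K : Subgroup A.Sections) [Finite K] [Y.IsSeparated] [IsSeparated (A.X.hom ≫ u)]
  [S.IsSeparated] (hcov : ∀ x : A.left, ∃ O : (A.translationActionOver u K).StableAffineOpens, x ∈ O.1)
  [LocallyOfFiniteType (A.X.hom ≫ u)] [IsLocallyNoetherian Y] [IsAffine Y]
  (hG : ∃ _ : GrpObj (A.quotientOver u K), IsMonHom (A.quotientMk u K hcov))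
  (hsm : Smooth (A.quotientOver u K).hom) (hgc : GeometricallyConnected (A.quotientOver u K).hom)
  (hfree : ∀ (Ω : Type u) [Field Ω] [IsAlgClosed Ω] (x : Spec (.of Ω) ⟶ A.left) (σ : K), σ ≠ 1 →
    x ≫ (A.translation (σ : A.Sections)).left ≠ x)
  {M : ℕ} (hK : ∀ σ : K, (σ : A.Sections) ^ M = 1)

/-! ## §1 The fibrewise kernel of `ψ` is killed by `M`; `ψ` is bijective on torsion prime to `M` -/

section Kernel

include hfree hK in
/-- **`x ≫ ψ = 1 → x ^ M = 1`** on geometric fibre points: the kernel of `ψ : A → A∕K` is `K(s)` (★ `comp_quotientMk_eq_one_iff`), killed by `M`.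
[cite: MumfordAV1970, §7 Thm. 4 (p. 72)] -/
theorem pow_eq_one_of_comp_quotientMk_eq_one ⦃Ω : Type u⦄ [Field Ω] [IsAlgClosed Ω] (s : Spec (.of Ω) ⟶ S) (x : A.FibrePoints s)
    (hx : x ≫ A.quotientMk u K hcov = (1 : (A.quotientBy u K hcov hG hsm hgc).FibrePoints s)) : x ^ M = 1 := by
  obtain ⟨σ, rfl⟩ := (A.comp_quotientMk_eq_one_iff u K hcov hG hsm hgc hfree s x).1 hx
  rw [← A.restrict_pow s, hK σ, A.restrict_one s]

include hfree hK in
/-- **`ψ` is INJECTIVE on `n`-torsion fibre points** when `(M, n) = 1`. [cite: MumfordAV1970, §7 Thm. 4 (p. 72)] [cite: MumfordFogartyKirwan1994, App. 7A (p. 235)] -/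
theorem eq_one_of_pow_eq_one_of_comp_quotientMk_eq_one {n : ℕ} (hcop : Nat.Coprime M n)
    ⦃Ω : Type u⦄ [Field Ω] [IsAlgClosed Ω] (s : Spec (.of Ω) ⟶ S) (x : A.FibrePoints s) (hn : x ^ n = 1)
    (hx : x ≫ A.quotientMk u K hcov = (1 : (A.quotientBy u K hcov hG hsm hgc).FibrePoints s)) : x = 1 := by
  haveI : IsMonHom (show A.X ⟶ (A.quotientBy u K hcov hG hsm hgc).X from A.quotientMk u K hcov) :=
    A.isMonHom_quotientMk u K hcov hG hsm hgc
  exact eq_one_of_pow_eq_one_of_comp_eq_one (A := A) (B := A.quotientBy u K hcov hG hsm hgc) (A.quotientMk u K hcov) hcop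
    (fun _ _ _ s' x' hx' => A.pow_eq_one_of_comp_quotientMk_eq_one u K hcov hG hsm hgc hfree hK s' x' hx') s x hn hx

include hfree hK in
/-- **`ψ` is ONTO on `n`-torsion fibre points** when `(M, n) = 1`: every `n`-torsion point of `(A∕K)_s` is `x ≫ ψ` for an `n`-torsion `x` of `A_s`
(★ `quotientBy_ontoFibres` + Bézout, ★ `exists_pow_eq_one_and_comp_eq`). [cite: MumfordAV1970, §7 Thm. 4 (p. 72)] [cite: MumfordFogartyKirwan1994, App. 7A (p. 235)] -/
theorem exists_pow_eq_one_and_comp_quotientMk_eq {n : ℕ} (hcop : Nat.Coprime M n)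
    ⦃Ω : Type u⦄ [Field Ω] [IsAlgClosed Ω] (s : Spec (.of Ω) ⟶ S) (y : (A.quotientBy u K hcov hG hsm hgc).FibrePoints s) (hy : y ^ n = 1) :
    ∃ x : A.FibrePoints s, x ^ n = 1 ∧ x ≫ A.quotientMk u K hcov = y := by
  haveI : IsMonHom (show A.X ⟶ (A.quotientBy u K hcov hG hsm hgc).X from A.quotientMk u K hcov) :=
    A.isMonHom_quotientMk u K hcov hG hsm hgc
  exact exists_pow_eq_one_and_comp_eq (A := A) (B := A.quotientBy u K hcov hG hsm hgc) (A.quotientMk u K hcov) hcop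
    (A.quotientBy_ontoFibres u K hcov hG hsm hgc)
    (fun _ _ _ s' x' hx' => A.pow_eq_one_of_comp_quotientMk_eq_one u K hcov hG hsm hgc hfree hK s' x' hx') s y hy

end Kernel

/-! ## §2 The induced level structure on `A ∕ K` -/

section Level

variable {g n : ℕ}

include hfree hK in
/-- **THE LEVEL STRUCTURE OF `A ∕ K`**: for `K` killed by `M` with `Nat.Coprime M n`, a level-`n` structure `φ` on `A` induces one on `A∕K` with sections
`φ.σ i ≫ ψ` (★ `LevelStructure.exists_comp_of_torsionBijOn`). [cite: MumfordFogartyKirwan1994, Ch. 7 §1 Def. 7.1 (p. 129), App. 7A (p. 235)]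
[cite: MumfordAV1970, §7 Thm. 4 (p. 72)] [cite: RapoportSmithlingZhang2020Diagonal, §4 (4.23) (p. 21)] -/
theorem LevelStructure.exists_comp_quotientMk_of_coprime (φ : A.LevelStructure g n) (hcop : Nat.Coprime M n) :
    ∃ ψφ : (A.quotientBy u K hcov hG hsm hgc).LevelStructure g n, ∀ i, ψφ.σ i = φ.σ i ≫ A.quotientMk u K hcov := by
  haveI : IsMonHom (show A.X ⟶ (A.quotientBy u K hcov hG hsm hgc).X from A.quotientMk u K hcov) :=
    A.isMonHom_quotientMk u K hcov hG hsm hgc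
  exact LevelStructure.exists_comp_of_torsionBijOn (A := A) (B := A.quotientBy u K hcov hG hsm hgc) φ (A.quotientMk u K hcov)
    (fun _ _ _ s x hn hx => A.eq_one_of_pow_eq_one_of_comp_quotientMk_eq_one u K hcov hG hsm hgc hfree hK hcop s x hn hx)
    (fun _ _ _ s y hy => A.exists_pow_eq_one_and_comp_quotientMk_eq u K hcov hG hsm hgc hfree hK hcop s y hy)

include hfree hK in
/-- **Uniqueness**: the induced level structure on `A∕K` is unique (a level structure is determined by its sections).
[cite: MumfordFogartyKirwan1994, Ch. 7 §1 Def. 7.1 (p. 129)] -/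
theorem LevelStructure.existsUnique_comp_quotientMk_of_coprime (φ : A.LevelStructure g n) (hcop : Nat.Coprime M n) :
    ∃! ψφ : (A.quotientBy u K hcov hG hsm hgc).LevelStructure g n, ∀ i, ψφ.σ i = φ.σ i ≫ A.quotientMk u K hcov := by
  haveI : IsMonHom (show A.X ⟶ (A.quotientBy u K hcov hG hsm hgc).X from A.quotientMk u K hcov) :=
    A.isMonHom_quotientMk u K hcov hG hsm hgc
  exact LevelStructure.existsUnique_comp_of_torsionBijOn (A := A) (B := A.quotientBy u K hcov hG hsm hgc) φ (A.quotientMk u K hcov)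
    (fun _ _ _ s x hn hx => A.eq_one_of_pow_eq_one_of_comp_quotientMk_eq_one u K hcov hG hsm hgc hfree hK hcop s x hn hx)
    (fun _ _ _ s y hy => A.exists_pow_eq_one_and_comp_quotientMk_eq u K hcov hG hsm hgc hfree hK hcop s y hy)

end Level

end AbelianSchemeOver

end Literature.AlgebraicGeometry.AbelianSchemes
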